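import Mathlib
import Summits.CriticalPhenomena.CardyFormulaZ2.Theorems.CardyMagicRigidityNestingRigidityUVFarBiteSqDomination
import Summits.CriticalPhenomena.CardyFormulaZ2.Theorems.CardyMagicRigidityNestingRigidityUVFarBiteSqMultiScale
import HarnessLib

/-!
# Crux `NestingRigidity`, line `positive-cone-weight-doubling`: Ξ₂ — all-order exponential moments of
# the squared far bites `Σ_{far u} (φ_u − ψ_u)²` of the cone cloud, both lattices

Crux `Summit.CriticalPhenomena.CardyFormulaZ2.Theses.CardyMagicRigidity.NestingRigidity`
(stmt-CriticalPhenomena-4835), line `positive-cone-weight-doubling`, registered helper Ξ₂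
`uvFarBiteSq_expMoment_latticeEnsembles` (input (Ξ₂) of `uvExpMoments_of_chargeFree_bounds`, hence
of [A] `uvExpMoments_latticeEnsembles` and of R1' `stub_uvDecoupling`): for `E ∈ latticeEnsembles`
and every `a > 0` there are `C, r₀ > 0` with
`E_δ exp(a Σ_{u ∈ X_δ, trace u ∩ A* = ∅} (φ_u − ψ_u)²) ≤ C` for all `r ∈ (0, r₀)` and all small
meshes (`A* = B̄(0, 1+2δ) ∖ B(0, r−2δ)`; `φ_u`, `ψ_u` the fractions of the disc `B(0, r)` and of the
ring `{1 ≤ |z| < 2}` inside the winding interior of `u`).  Here `r₀ = 1` and the bound holds for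
EVERY mesh `δ > 0`.  Proof (no cited fact, no definition):

* §1 the far family splits into the INNER loops (trace in `B(0, r−2δ)`, finitely many) and the OUTER
  loops (trace off `B̄(0, 1+2δ)`), whose contributing members meet `B̄(0, 2)` (finitely many):
  `S = S₁ + S₂` pathwise (`farBiteSq_le_latticeEnsembles`, …UVFarBiteSqDomination);
* §2 a dominated statistic has all its exponential moments bounded by the multi-scale constant:
  `S₁ ≤ Σ_{inner} min(1, diam⁴/r⁴)` and `S₂ ≤ Σ_{outer, meeting B̄(0,2)} min(1, diam⁴)` are dominated,
  for a depth `n(ω)` resolving the finitely many diameters, by the weighted cumulative big-loop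
  counts `Σ_{k<n} 16^{-k} N_k` (`sum_min_le_sum_card`), whose exponential moments are bounded
  uniformly in `n`, `r`, `δ` (`expMoment_weightedBigLoops_le_latticeEnsembles`, …UVFarBiteSqMultiScale);
  the Fatou-type lemma `integral_le_of_le_some` transfers the bound;
* §3 `exp(a S) = exp(a S₁) exp(a S₂) ≤ (exp(2a S₁) + exp(2a S₂))/2`, so `C = (C₁ + C₂)/2`.
-/

noncomputable section

open MeasureTheory Set Filter Metric
open scoped Real Topology BigOperators

namespace Summit.CriticalPhenomena.CardyFormulaZ2.Cruxes.NestingRigidity.PositiveConeWeightDoubling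

open Literature.Probability.RandomPlanarGeometry Literature.Probability.Percolation
  Literature.Probability.LatticeModels
open Summit.CriticalPhenomena.CardyFormulaZ2.Cruxes.NestingRigidity.RingCloudTomography

namespace UVFarBiteSq

/-! ## §1 The far family: inner loops and contributing outer loops -/

/-- **Splitting a far sum**: for a loop family whose members meeting `B̄(0, 2)` are finitely many and
a loop function vanishing off the loops meeting `B̄(0, 2)`, the sum over the far loops (trace off
`B̄(0, R₂) ∖ B(0, R₁)`, `R₁ ≤ R₂`) is the sum over the inner loops (trace in `B(0, R₁)`) plus the sum
over the outer loops (trace off `B̄(0, R₂)`) meeting `B̄(0, 2)` — honest finite sums. -/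
theorem finsum_far_split (Lps : Set (UnbasedLoop ℂ)) (t : UnbasedLoop ℂ → ℝ) {R₁ R₂ : ℝ} (hR : R₁ ≤ R₂)
    (hfin : {u ∈ Lps | (u.range ∩ closedBall (0 : ℂ) 2).Nonempty}.Finite)
    (ht : ∀ u, t u ≠ 0 → (u.range ∩ closedBall (0 : ℂ) 2).Nonempty) :
    ∑ᶠ u ∈ {u ∈ Lps | Disjoint u.range (closedBall (0 : ℂ) R₂ \ ball 0 R₁)}, t u =
      ∑ᶠ u ∈ {u ∈ Lps | u.range ⊆ ball (0 : ℂ) R₁}, t u +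
        ∑ᶠ u ∈ {u ∈ Lps | u.range ⊆ (closedBall (0 : ℂ) R₂)ᶜ ∧ (u.range ∩ closedBall (0 : ℂ) 2).Nonempty}, t u := by
  have hfar : {u ∈ Lps | Disjoint u.range (closedBall (0 : ℂ) R₂ \ ball 0 R₁)} =
      {u ∈ Lps | u.range ⊆ ball (0 : ℂ) R₁} ∪ {u ∈ Lps | u.range ⊆ (closedBall (0 : ℂ) R₂)ᶜ} := by
    ext u
    simp only [mem_setOf_eq, mem_union]
    constructor
    · rintro ⟨hu, hd⟩
      rcases range_subset_or_of_disjoint hR hd with h | h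
      · exact Or.inl ⟨hu, h⟩
      · exact Or.inr ⟨hu, h⟩
    · rintro (⟨hu, h⟩ | ⟨hu, h⟩)
      · exact ⟨hu, Set.disjoint_left.2 fun z hz hz' ↦ hz'.2 (h hz)⟩
      · exact ⟨hu, Set.disjoint_left.2 fun z hz hz' ↦ h hz hz'.1⟩
  have hdisj : Disjoint {u ∈ Lps | u.range ⊆ ball (0 : ℂ) R₁} {u ∈ Lps | u.range ⊆ (closedBall (0 : ℂ) R₂)ᶜ} := by
    refine Set.disjoint_left.2 fun u hu hu' ↦ ?_
    obtain ⟨z, hz⟩ := u.range_nonempty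
    exact hu'.2 hz (ball_subset_closedBall (ball_subset_ball hR (hu.2 hz)))
  have hsupp : ∀ s : Set (UnbasedLoop ℂ), s ⊆ Lps → (s ∩ Function.support t).Finite := fun s hs ↦
    hfin.subset fun u hu ↦ ⟨hs hu.1, ht u hu.2⟩
  rw [hfar, finsum_mem_union' hdisj (hsupp _ fun u hu ↦ hu.1) (hsupp _ fun u hu ↦ hu.1)]
  congr 1
  exact finsum_mem_inter_support_eq' t _ _ fun u hu ↦
    ⟨fun h ↦ ⟨h.1, h.2, ht u hu⟩, fun h ↦ ⟨h.1, h.2.1⟩⟩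

/-- A loop meeting `B̄(x₀, ρ)` meets `B̄(0, ‖x₀‖ + ρ)`. -/
theorem meets_closedBall_zero {u : UnbasedLoop ℂ} {x₀ : ℂ} {ρ : ℝ}
    (h : (u.range ∩ closedBall x₀ ρ).Nonempty) : (u.range ∩ closedBall (0 : ℂ) (‖x₀‖ + ρ)).Nonempty := by
  obtain ⟨z, hz, hz'⟩ := h
  refine ⟨z, hz, ?_⟩
  rw [mem_closedBall, dist_zero_right]
  rw [mem_closedBall, dist_eq_norm] at hz'
  calc ‖z‖ = ‖z - x₀ + x₀‖ := by rw [sub_add_cancel]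
    _ ≤ ‖z - x₀‖ + ‖x₀‖ := norm_add_le _ _
    _ ≤ ‖x₀‖ + ρ := by linarith

/-! ## §2 Dominated statistics have bounded exponential moments -/

/-- **Exponential moments of a dominated statistic, both lattices.**  At a fixed mesh `δ > 0`, let
`S ≥ 0` be a measurable statistic such that every sample admits a finite family `F` of loops of
`X_δ` meeting `B̄(x₀, R₀ρ)` with `S ≤ Σ_{u ∈ F} min(1, diam(u)⁴/ρ⁴)`.  If the weighted cumulative
big-loop counts `Σ_{k<n} (b/16^k)·#{u ∈ X_δ : trace ∩ B̄(x₀, R₀ρ) ≠ ∅, diam ≥ ρ/2^{k+1}}` have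
`E_δ exp ≤ C` for every depth `n`, then `E_δ exp(b S) ≤ C` (`b ≥ 0`; integrability included): a depth
resolving the finitely many diameters of `F` dominates `S` (`sum_min_le_sum_card`), and the
Fatou-type lemma `integral_le_of_le_some` applies along the monotone depths. -/
theorem expMoment_le_of_dominated : ∀ E ∈ latticeEnsembles, ∀ {δ : ℝ}, 0 < δ →
    ∀ (x₀ : ℂ) (R₀ ρ b C : ℝ), 0 < ρ → 0 ≤ b → ∀ (S : E.Ω → ℝ), Measurable S → (∀ ω, 0 ≤ S ω) →
    (∀ ω, ∃ F : Finset (UnbasedLoop ℂ),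
      (∀ u ∈ F, u ∈ (E.X δ ω).loops ∧ (u.range ∩ closedBall x₀ (R₀ * ρ)).Nonempty) ∧
        S ω ≤ ∑ u ∈ F, min 1 ((diam u.range / ρ) ^ 4)) →
    (∀ n : ℕ, Integrable (fun ω ↦ Real.exp (∑ k ∈ Finset.range n, b / 16 ^ k * ({u ∈ (E.X δ ω).loops |
        (u.range ∩ closedBall x₀ (R₀ * ρ)).Nonempty ∧ ρ / 2 ^ (k + 1) ≤ diam u.range}.ncard : ℝ))) E.P ∧
      ∫ ω, Real.exp (∑ k ∈ Finset.range n, b / 16 ^ k * ({u ∈ (E.X δ ω).loops |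
        (u.range ∩ closedBall x₀ (R₀ * ρ)).Nonempty ∧ ρ / 2 ^ (k + 1) ≤ diam u.range}.ncard : ℝ)) ∂E.P ≤ C) →
    Integrable (fun ω ↦ Real.exp (b * S ω)) E.P ∧ ∫ ω, Real.exp (b * S ω) ∂E.P ≤ C := by
  intro E hE δ hδ x₀ R₀ ρ b C hρ hb S hSm hS0 hdom hM
  haveI := isProbabilityMeasure_of_mem hE
  have hNm : ∀ k, Measurable fun ω ↦ ({u ∈ (E.X δ ω).loops |
      (u.range ∩ closedBall x₀ (R₀ * ρ)).Nonempty ∧ ρ / 2 ^ (k + 1) ≤ diam u.range}.ncard : ℝ) := fun k ↦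
    measurable_from_nat.comp (BigLoops.measurable_ncard_loops_sep E hE δ _)
  refine integral_le_of_le_some
    (g := fun n ω ↦ Real.exp (∑ k ∈ Finset.range n, b / 16 ^ k * ({u ∈ (E.X δ ω).loops |
      (u.range ∩ closedBall x₀ (R₀ * ρ)).Nonempty ∧ ρ / 2 ^ (k + 1) ≤ diam u.range}.ncard : ℝ)))
    (Real.measurable_exp.comp (hSm.const_mul b)) (fun ω ↦ (Real.exp_pos _).le)
    (fun n ↦ Real.measurable_exp.comp (Finset.measurable_sum _ fun k _ ↦ (hNm k).const_mul _))
    (fun n ω ↦ (Real.exp_pos _).le)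
    (fun ω n m hnm ↦ Real.exp_le_exp.2 (Finset.sum_le_sum_of_subset_of_nonneg
      (Finset.range_mono hnm) fun k _ _ ↦ by positivity))
    (fun ω ↦ ?_) (fun n ↦ (hM n).1) (fun n ↦ (hM n).2)
  obtain ⟨F, hF, hSF⟩ := hdom ω
  -- a depth resolving all positive diameters of `F`
  obtain ⟨n, hn0, hn⟩ : ∃ n : ℕ, 0 < n ∧ ∀ u ∈ F, 0 < diam u.range → ρ / 2 ^ n ≤ diam u.range := by
    have hev : ∀ u ∈ F, ∀ᶠ n : ℕ in atTop, 0 < diam u.range → ρ / 2 ^ n ≤ diam u.range := by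
      intro u _
      by_cases hd : 0 < diam u.range
      · have ht : Tendsto (fun n : ℕ ↦ ρ / 2 ^ n) atTop (𝓝 0) :=
          tendsto_const_nhds.div_atTop (tendsto_pow_atTop_atTop_of_one_lt one_lt_two)
        exact (ht.eventually (Iic_mem_nhds hd)).mono fun n hn _ ↦ hn
      · exact Eventually.of_forall fun n h ↦ absurd h hd
    obtain ⟨n, hn⟩ := ((eventually_gt_atTop 0).and ((Finset.eventually_all F).2 hev)).exists
    exact ⟨n, hn.1, hn.2⟩
  refine ⟨n, Real.exp_le_exp.2 ?_⟩
  have key := sum_min_le_sum_card F (fun u ↦ diam u.range) hρ (fun u _ ↦ diam_nonneg) hn0 hn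
  have hcard : ∀ k, ((F.filter fun u ↦ ρ / 2 ^ (k + 1) ≤ diam u.range).card : ℝ) ≤
      ({u ∈ (E.X δ ω).loops | (u.range ∩ closedBall x₀ (R₀ * ρ)).Nonempty ∧
        ρ / 2 ^ (k + 1) ≤ diam u.range}.ncard : ℝ) := by
    intro k
    obtain ⟨M, hM'⟩ := BigLoopsMeet.exists_ncard_loops_sep_meeting_le E hE hδ (‖x₀‖ + R₀ * ρ)
    have hfin : {u ∈ (E.X δ ω).loops | (u.range ∩ closedBall x₀ (R₀ * ρ)).Nonempty ∧
        ρ / 2 ^ (k + 1) ≤ diam u.range}.Finite :=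
      (hM' _ (fun u hu ↦ meets_closedBall_zero hu.1) ω).1
    rw [Set.ncard_eq_toFinset_card _ hfin]
    exact_mod_cast Finset.card_le_card fun u hu ↦ by
      rw [Finset.mem_filter] at hu
      rw [Set.Finite.mem_toFinset]
      exact ⟨(hF u hu.1).1, (hF u hu.1).2, hu.2⟩
  calc b * S ω ≤ b * ∑ u ∈ F, min 1 ((diam u.range / ρ) ^ 4) := mul_le_mul_of_nonneg_left hSF hb
    _ ≤ b * ∑ k ∈ Finset.range n, 1 / (16 : ℝ) ^ k *
          ((F.filter fun u ↦ ρ / 2 ^ (k + 1) ≤ diam u.range).card : ℝ) := mul_le_mul_of_nonneg_left key hb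
    _ ≤ b * ∑ k ∈ Finset.range n, 1 / (16 : ℝ) ^ k * ({u ∈ (E.X δ ω).loops |
          (u.range ∩ closedBall x₀ (R₀ * ρ)).Nonempty ∧ ρ / 2 ^ (k + 1) ≤ diam u.range}.ncard : ℝ) :=
        mul_le_mul_of_nonneg_left (Finset.sum_le_sum fun k _ ↦
          mul_le_mul_of_nonneg_left (hcard k) (by positivity)) hb
    _ = ∑ k ∈ Finset.range n, b / 16 ^ k * ({u ∈ (E.X δ ω).loops |
          (u.range ∩ closedBall x₀ (R₀ * ρ)).Nonempty ∧ ρ / 2 ^ (k + 1) ≤ diam u.range}.ncard : ℝ) := by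
        rw [Finset.mul_sum]
        refine Finset.sum_congr rfl fun k _ ↦ ?_
        ring

end UVFarBiteSq

/-! ## §3 The registered statement Ξ₂ -/

open UVFarBiteSq in
/-- **Ξ₂: all-order exponential moments of the squared far bites of the cone cloud, both lattice
ensembles** (registered helper toward [A] `uvExpMoments_latticeEnsembles` via
`uvExpMoments_of_chargeFree_bounds`, line `positive-cone-weight-doubling`).  For
`E ∈ latticeEnsembles` and every order `a > 0` there are `C` and `r₀ > 0` (here `r₀ = 1`) such that
for all `r ∈ (0, r₀)` and all small meshes (here: all `δ > 0`),
`E_δ exp(a Σ_{u ∈ X_δ, trace u ∩ (B̄(0, 1+2δ) ∖ B(0, r−2δ)) = ∅} (φ_u − ψ_u)²) ≤ C`, `φ_u`, `ψ_u`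
the fractions of the disc `B(0, r)` and of the ring `{1 ≤ |z| < 2}` inside the winding interior of
`u`.  The statistic is nonnegative and NOT centred; it splits into the inner part (dyadic scales
below `r`, weights `min(1, diam⁴/r⁴)`) and the outer part (scales below and above `1`, weights
`min(1, diam⁴)`, the big loops crossing out of every window included), each dominated pathwise by
geometrically weighted cumulative big-loop counts whose exponential moments are bounded uniformly
by Hölder over covers and scales and K6 at all centres and scales
(`expMoment_weightedBigLoops_le_latticeEnsembles`); `exp(a S) ≤ (exp(2a S₁) + exp(2a S₂))/2`. -/
theorem uvFarBiteSq_expMoment_latticeEnsembles : ∀ E ∈ latticeEnsembles, ∀ a : ℝ, 0 < a → ∃ C r₀ : ℝ, 0 < r₀ ∧ ∀ r ∈ Set.Ioo (0 : ℝ) r₀, ∀ᶠ δ in 𝓝[>] (0 : ℝ), ∫ ω, Real.exp (a * ∑ᶠ u ∈ {u ∈ (E.X δ ω).loops | Disjoint u.range (Metric.closedBall (0 : ℂ) (1 + 2 * δ) \ Metric.ball 0 (r - 2 * δ))}, ((∫ z in {z | u.wind z ≠ 0}, discDensity 0 r z) - ∫ z in {z | u.wind z ≠ 0}, annulusDensity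 0 1 2 z) ^ 2) ∂E.P ≤ C := by
  intro E hE a ha
  haveI := isProbabilityMeasure_of_mem hE
  obtain ⟨C₁, hC₁, h₁⟩ :=
    expMoment_weightedBigLoops_le_latticeEnsembles E hE (2 * a) 1 (by positivity) le_rfl
  obtain ⟨C₂, hC₂, h₂⟩ :=
    expMoment_weightedBigLoops_le_latticeEnsembles E hE (2 * a) 2 (by positivity) (by norm_num)
  refine ⟨(C₁ + C₂) / 2, 1, one_pos, fun r hr ↦ ?_⟩
  obtain ⟨hr0, hr1⟩ := hr
  filter_upwards [self_mem_nhdsWithin] with δ hδ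
  rw [Set.mem_Ioi] at hδ
  -- the bite and its square
  set t : UnbasedLoop ℂ → ℝ := fun u ↦ ((∫ z in {z | u.wind z ≠ 0}, discDensity 0 r z) -
    ∫ z in {z | u.wind z ≠ 0}, annulusDensity 0 1 2 z) ^ 2 with ht_def
  have ht0 : ∀ u, 0 ≤ t u := fun u ↦ sq_nonneg _
  have htmeet : ∀ u, t u ≠ 0 → (u.range ∩ closedBall (0 : ℂ) 2).Nonempty := fun u hu ↦
    meets_of_bite_ne_zero hr0 hr1.le fun h ↦ hu (by rw [ht_def]; dsimp only; rw [h]; ring)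
  -- the two parts
  set S₁ : E.Ω → ℝ := fun ω ↦ ∑ᶠ u ∈ {u ∈ (E.X δ ω).loops | u.range ⊆ ball (0 : ℂ) (r - 2 * δ)}, t u
    with hS₁
  set S₂ : E.Ω → ℝ := fun ω ↦ ∑ᶠ u ∈ {u ∈ (E.X δ ω).loops |
    u.range ⊆ (closedBall (0 : ℂ) (1 + 2 * δ))ᶜ ∧ (u.range ∩ closedBall (0 : ℂ) 2).Nonempty}, t u with hS₂
  have hsplit : ∀ ω, ∑ᶠ u ∈ {u ∈ (E.X δ ω).loops |
      Disjoint u.range (closedBall (0 : ℂ) (1 + 2 * δ) \ ball 0 (r - 2 * δ))}, t u = S₁ ω + S₂ ω :=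
    fun ω ↦ finsum_far_split _ t (by linarith) (ConeTilt.finite_loops_meeting E hE hδ ω 2) htmeet
  have hper := farBiteSq_le_latticeEnsembles E hE hr0 hr1.le hδ.le
  -- §2 for the inner part
  have hS₁b : Integrable (fun ω ↦ Real.exp (2 * a * S₁ ω)) E.P ∧
      ∫ ω, Real.exp (2 * a * S₁ ω) ∂E.P ≤ C₁ := by
    refine expMoment_le_of_dominated E hE hδ 0 1 r (2 * a) C₁ hr0 (by positivity) S₁
      (FirstMoment.measurable_finsum_loops_sep E hE δ _ t)
      (fun ω ↦ finsum_nonneg fun u ↦ finsum_nonneg fun _ ↦ ht0 u) (fun ω ↦ ?_)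
      (fun n ↦ h₁ 0 r δ hr0 hδ n)
    have hfin : {u ∈ (E.X δ ω).loops | u.range ⊆ ball (0 : ℂ) (r - 2 * δ)}.Finite :=
      (ConeTilt.finite_loops_meeting E hE hδ ω 2).subset fun u hu ↦ ⟨hu.1, by
        obtain ⟨z, hz⟩ := u.range_nonempty
        refine ⟨z, hz, ?_⟩
        have := hu.2 hz
        rw [mem_ball, dist_zero_right] at this
        rw [mem_closedBall, dist_zero_right]
        linarith⟩
    refine ⟨hfin.toFinset, fun u hu ↦ ?_, ?_⟩
    · rw [Set.Finite.mem_toFinset] at hu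
      refine ⟨hu.1, ?_⟩
      obtain ⟨z, hz⟩ := u.range_nonempty
      refine ⟨z, hz, ?_⟩
      have := hu.2 hz
      rw [mem_ball, dist_zero_right] at this
      rw [mem_closedBall, dist_zero_right]
      linarith
    · rw [hS₁]
      dsimp only
      rw [finsum_mem_eq_finite_toFinset_sum _ hfin]
      refine Finset.sum_le_sum fun u hu ↦ ?_
      rw [Set.Finite.mem_toFinset] at hu
      rcases hper ω u ⟨hu.1, Set.disjoint_left.2 fun z hz hz' ↦ hz'.2 (hu.2 hz)⟩ with h | h
      · exact h.2
      · exfalso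
        obtain ⟨z, hz⟩ := u.range_nonempty
        have h1 := hu.2 hz
        have h2 := h.1 hz
        rw [mem_ball, dist_zero_right] at h1
        rw [Set.mem_compl_iff, mem_closedBall, dist_zero_right, not_le] at h2
        linarith
  -- §2 for the outer part
  have hS₂b : Integrable (fun ω ↦ Real.exp (2 * a * S₂ ω)) E.P ∧
      ∫ ω, Real.exp (2 * a * S₂ ω) ∂E.P ≤ C₂ := by
    refine expMoment_le_of_dominated E hE hδ 0 2 1 (2 * a) C₂ one_pos (by positivity) S₂
      (FirstMoment.measurable_finsum_loops_sep E hE δ _ t)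
      (fun ω ↦ finsum_nonneg fun u ↦ finsum_nonneg fun _ ↦ ht0 u) (fun ω ↦ ?_)
      (fun n ↦ h₂ 0 1 δ one_pos hδ n)
    have hfin : {u ∈ (E.X δ ω).loops | u.range ⊆ (closedBall (0 : ℂ) (1 + 2 * δ))ᶜ ∧
        (u.range ∩ closedBall (0 : ℂ) 2).Nonempty}.Finite :=
      (ConeTilt.finite_loops_meeting E hE hδ ω 2).subset fun u hu ↦ ⟨hu.1, hu.2.2⟩
    refine ⟨hfin.toFinset, fun u hu ↦ ?_, ?_⟩
    · rw [Set.Finite.mem_toFinset] at hu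
      exact ⟨hu.1, by rw [mul_one]; exact hu.2.2⟩
    · rw [hS₂]
      dsimp only
      rw [finsum_mem_eq_finite_toFinset_sum _ hfin]
      refine Finset.sum_le_sum fun u hu ↦ ?_
      rw [Set.Finite.mem_toFinset] at hu
      rw [div_one]
      rcases hper ω u ⟨hu.1, Set.disjoint_left.2 fun z hz hz' ↦ hu.2.1 hz hz'.1⟩ with h | h
      · exfalso
        obtain ⟨z, hz⟩ := u.range_nonempty
        have h1 := h.1 hz
        have h2 := hu.2.1 hz
        rw [mem_ball, dist_zero_right] at h1
        rw [Set.mem_compl_iff, mem_closedBall, dist_zero_right, not_le] at h2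
        linarith
      · exact h.2.1
  -- §3 assembly
  have hexp2 : ∀ x : ℝ, Real.exp x ^ 2 = Real.exp (2 * x) := fun x ↦ by
    rw [sq, ← Real.exp_add]; ring_nf
  calc ∫ ω, Real.exp (a * ∑ᶠ u ∈ {u ∈ (E.X δ ω).loops |
          Disjoint u.range (closedBall (0 : ℂ) (1 + 2 * δ) \ ball 0 (r - 2 * δ))}, t u) ∂E.P
      ≤ ∫ ω, (Real.exp (2 * a * S₁ ω) + Real.exp (2 * a * S₂ ω)) / 2 ∂E.P := by
        refine integral_mono_of_nonneg (Eventually.of_forall fun ω ↦ (Real.exp_pos _).le)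
          ((hS₁b.1.add hS₂b.1).div_const 2) (Eventually.of_forall fun ω ↦ ?_)
        dsimp only
        rw [hsplit ω, mul_add, Real.exp_add]
        have h := two_mul_le_add_sq (Real.exp (a * S₁ ω)) (Real.exp (a * S₂ ω))
        rw [hexp2, hexp2, ← mul_assoc, ← mul_assoc] at h
        linarith
    _ = ((∫ ω, Real.exp (2 * a * S₁ ω) ∂E.P) + ∫ ω, Real.exp (2 * a * S₂ ω) ∂E.P) / 2 := by
        rw [integral_div, integral_add hS₁b.1 hS₂b.1]
    _ ≤ (C₁ + C₂) / 2 := by linarith [hS₁b.2, hS₂b.2]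

end Summit.CriticalPhenomena.CardyFormulaZ2.Cruxes.NestingRigidity.PositiveConeWeightDoubling

end
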